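import Summits.CriticalPhenomena.PercolationContinuityZ3.Theorems.PercNearOneGluingNoHeavyQuantIndepBlobTwoLightCorner
import Summits.CriticalPhenomena.PercolationContinuityZ3.Theorems.PercNearOneGluingNoHeavyQuantIndepBlobExtraBlobs
import HarnessLib

/-!
# QUANT lane R8, T-DIB: Conjecture DIB\* for every system with exactly two light blobs, floor above one half
# (DIB\*'s binder shape; heavy total `≤ 2j` by the corner theorem, `≥ 2j+1` by the odd-size row with extra blobs)

builds on p205010 (kernel theorem, internal audit signed; external expert review pending)

Support file (`--supports stmt-CriticalPhenomena-4575`), QUANT lane seat prim-quant-p1 (gen 12); memo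
`run/shared/lean/prim/quant/P1-SURPLUS.md` §23.7.  Theorems only; no definitions, no sorries, standard axioms.

`Quant.IndepBlob.dibStar_of_twoLights`: floor `1/2 < x < 1`; gates in `[0,1]`; exactly two blobs `ℓ₁ ≠ ℓ₂` below the floor, with
gates in `[x², x)` and sizes in `[1, j]` (the DIB\* side condition); every other blob at or above the floor; the DIB\* credit
`2j < Σ_k a_k ψ*_x(g_k)` (`ψ*_x(g) = g` for `g ≥ x`, `(g − x²)/(1−x)` below).  Then `x ≤ P(N ≥ j+1)`.
(Lights with gate `< x²` carry negative credit and lights of size `0` are invisible, so up to relabelling this is Conjecture DIB\*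
(`Quant.IndepBlob.DIBStar`) on the corner `x > 1/2` for all systems with at most two sub-floor blobs; floors `x ≤ 1/2` are the kernel
row `dibStar_of_le_half`.)  Proof: heavy total `≤ 2j` — `tail_ge_of_twoLights_corner`; heavy total `≥ 2j+1` — lead g15's
`sizeRow_with_extra_blobs` at the least heavy gate.  [cite: KozmaNitzan2024, Conjecture 3 (p. 15)] (the gluing rows served); [this work].
-/

namespace Summit.CriticalPhenomena.PercolationContinuityZ3.Theorems

namespace Quant

namespace IndepBlob

open Finset

/-- **DIB\* for systems with exactly two light blobs, floor `> 1/2`** (binder shape of `DIBStar`).  See the module docstring.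
[this work] -/
theorem dibStar_of_twoLights {κ : Type*} [Fintype κ] [DecidableEq κ] (x : ℝ) (hx : 1 / 2 < x) (hx1 : x < 1)
    (a : κ → ℕ) (g : κ → ℝ) (j : ℕ) (hg : ∀ k, 0 ≤ g k ∧ g k ≤ 1) (ℓ₁ ℓ₂ : κ) (hne : ℓ₁ ≠ ℓ₂)
    (hℓ₁ : x ^ 2 ≤ g ℓ₁ ∧ g ℓ₁ < x) (hℓ₂ : x ^ 2 ≤ g ℓ₂ ∧ g ℓ₂ < x) (hheavy : ∀ k, k ≠ ℓ₁ → k ≠ ℓ₂ → x ≤ g k)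
    (hsz₁ : 1 ≤ a ℓ₁ ∧ a ℓ₁ ≤ j) (hsz₂ : 1 ≤ a ℓ₂ ∧ a ℓ₂ ≤ j)
    (hcredit : (2 * j : ℝ) < ∑ k, (a k : ℝ) * (if x ≤ g k then g k else (g k - x ^ 2) / (1 - x))) :
    x ≤ ∑ W : Finset κ, (∏ k, if k ∈ W then g k else 1 - g k) * (if j + 1 ≤ ∑ k ∈ W, a k then (1 : ℝ) else 0) := by
  have hp0 : ∀ k, 0 ≤ g k := fun k => (hg k).1
  have hp1 : ∀ k, g k ≤ 1 := fun k => (hg k).2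
  -- the credit split over the heavy set `Sᶜ` and the two lights, for either labelling
  have hsplit : ∀ (u v : κ), u ≠ v → g u < x → g v < x → (∀ k, k ≠ u → k ≠ v → x ≤ g k) →
      ∑ k, (a k : ℝ) * (if x ≤ g k then g k else (g k - x ^ 2) / (1 - x)) =
        (∑ k ∈ (insert v (insert u (∅ : Finset κ)))ᶜ, (a k : ℝ) * g k) +
          (a u : ℝ) * ((g u - x ^ 2) / (1 - x)) + (a v : ℝ) * ((g v - x ^ 2) / (1 - x)) := by
    intro u v huv hu hv hh
    rw [← Finset.sum_compl_add_sum (insert v (insert u (∅ : Finset κ)))]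
    have hvu : v ∉ insert u (∅ : Finset κ) := by
      rw [Finset.mem_insert]; push Not; exact ⟨huv.symm, Finset.notMem_empty _⟩
    rw [Finset.sum_insert hvu, Finset.sum_insert (Finset.notMem_empty _), Finset.sum_empty,
      if_neg (not_le.2 hv), if_neg (not_le.2 hu)]
    have hc : ∑ k ∈ (insert v (insert u (∅ : Finset κ)))ᶜ, (a k : ℝ) * (if x ≤ g k then g k else (g k - x ^ 2) / (1 - x)) =
        ∑ k ∈ (insert v (insert u (∅ : Finset κ)))ᶜ, (a k : ℝ) * g k := by
      refine Finset.sum_congr rfl fun k hk => ?_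
      rw [Finset.mem_compl, Finset.mem_insert, Finset.mem_insert] at hk
      push Not at hk
      rw [if_pos (hh k hk.2.1 hk.1)]
    rw [hc]; ring
  -- heavy total
  set S : Finset κ := insert ℓ₂ (insert ℓ₁ (∅ : Finset κ)) with hS
  by_cases hA : ∑ k ∈ Sᶜ, a k ≤ 2 * j
  · -- corner theorem, with the bigger light first
    rcases le_total (a ℓ₂) (a ℓ₁) with h21 | h12
    · have hc := hsplit ℓ₁ ℓ₂ hne hℓ₁.2 hℓ₂.2 hheavy
      rw [hc] at hcredit
      exact tail_ge_of_twoLights_corner g a x j hx hx1 hp0 hp1 ℓ₁ ℓ₂ hne h21 hsz₂.1 hsz₁.2 hℓ₁.1 hℓ₁.2 hℓ₂.1 hℓ₂.2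
        hheavy hA hcredit
    · have hheavy' : ∀ k, k ≠ ℓ₂ → k ≠ ℓ₁ → x ≤ g k := fun k h2 h1 => hheavy k h1 h2
      have hc := hsplit ℓ₂ ℓ₁ hne.symm hℓ₂.2 hℓ₁.2 hheavy'
      rw [hc] at hcredit
      have hS' : insert ℓ₁ (insert ℓ₂ (∅ : Finset κ)) = S := Finset.insert_comm _ _ _
      have hA' : ∑ k ∈ (insert ℓ₁ (insert ℓ₂ (∅ : Finset κ)))ᶜ, a k ≤ 2 * j := by rw [hS']; exact hA
      exact tail_ge_of_twoLights_corner g a x j hx hx1 hp0 hp1 ℓ₂ ℓ₁ hne.symm h12 hsz₁.1 hsz₂.2 hℓ₂.1 hℓ₂.2 hℓ₁.1 hℓ₁.2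
        hheavy' hA' hcredit
  · -- heavy total `≥ 2j+1`: the odd-size row with the two lights as extra blobs, at the least heavy gate
    have hA' : 2 * j + 1 ≤ ∑ k ∈ Sᶜ, a k := by omega
    have hne' : (Sᶜ : Finset κ).Nonempty := by
      by_contra h
      rw [Finset.not_nonempty_iff_eq_empty] at h
      rw [h, Finset.sum_empty] at hA'
      omega
    obtain ⟨y₀, hy₀S, hy₀min⟩ := Finset.exists_min_image Sᶜ g hne'
    have hmemS : ∀ k, k ∉ S ↔ (k ≠ ℓ₁ ∧ k ≠ ℓ₂) := by
      intro k
      rw [hS, Finset.mem_insert, Finset.mem_insert]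
      push Not
      exact ⟨fun h => ⟨h.2.1, h.1⟩, fun h => ⟨h.2, h.1, Finset.notMem_empty _⟩⟩
    have hy₀S' : y₀ ∉ S := Finset.mem_compl.1 hy₀S
    have hy₀x : x ≤ g y₀ := hheavy y₀ ((hmemS y₀).1 hy₀S').1 ((hmemS y₀).1 hy₀S').2
    have hrow := sizeRow_with_extra_blobs g a hp0 hp1 S y₀ hy₀S' (fun k hk => hy₀min k (Finset.mem_compl.2 hk))
      (by linarith) j (by rw [← Finset.sum_compl_add_sum S a]; omega)
    rw [Finset.sum_filter] at hrow
    refine le_trans hy₀x (le_trans hrow (le_of_eq (Finset.sum_congr rfl fun s _ => ?_)))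
    split_ifs <;> simp

end IndepBlob

end Quant

end Summit.CriticalPhenomena.PercolationContinuityZ3.Theorems
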